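import Summits.CriticalPhenomena.PercolationContinuityZ3.Theorems.Transplant.KNParaChainCorridorN
import Summits.CriticalPhenomena.PercolationContinuityZ3.Theorems.Transplant.SkelPhiParaVLocChain
import HarnessLib

/-!
# N1 (the `{±1}` node), LEVEL 1, (C) column file (C-N5b): THE RUN-FRAME SEGMENT OF THE (C) CORRIDOR WITH A SIGNED BAND — `ChainPara.corrRunSchedS`:
# the signed u-rounds `P₂` (axis `0`, centre `0`) followed by the band `B` along `aB` with SIGN `σB = ±1` (= `sgOf du`, the corridor's direction; origin
# `0`), so that a corridor in a NEGATIVE direction is run in the SAME run frame `runX φ c₀ n h 1` (no frame sign, no floor asymmetry); the join lemmas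
# `join_xS / join_yS / joinReg_xS / joinReg_yS` for either sign (the rounds' last core is symmetric), the segment's API, and the PHASE-1 planar rooms
# restated for the `(e − z)`-enlarged rounds `scheduleNz` of (C-N8) (`phase1z_core_zero_supset_M`, `phase1z_region_subset_Q`, `phase1z_mem_core_last`).

builds on p205010 (kernel theorem, internal audit signed; external expert review pending) — nothing in this file uses p205010; nothing here is a
claim about the open node `SamePDropOfSkeletonNeg`.
Lane `prim-bschramm`, seat `prim-bschramm-p5` (gen 8; (C) lineage; C-FUNNEL.md §2–§3); helper file (`--supports stmt-CriticalPhenomena-4575`).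
[cite: KozmaNitzan2024, §4 Lemma 12 (pp. 23–25), p. 26 (Q_v, M_v)] [cite: MartineauTassion2017, §4.3 Lemma 4.2]
-/

noncomputable section

namespace Summit.CriticalPhenomena.PercolationContinuityZ3.Theorems

namespace Transplant

namespace ChainPara

open Literature.Probability.Percolation Literature.Probability.LatticeModels
open Literature.Probability.Percolation.KozmaNitzan
open Literature.Probability.Percolation.KozmaNitzan.Cells (oth oth_ne eq_oth_of_ne)
open ChainPlanar

/-- `oth 1 = 0` on `Fin 2`. [folklore] -/
private theorem oth_one'' : oth (1 : Fin 2) = 0 := by decide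

/-- `oth 0 = 1` on `Fin 2`. [folklore] -/
private theorem oth_zero'' : oth (0 : Fin 2) = 1 := by decide

/-! ## §1 Phase 1 rooms for the `(e − z)`-enlarged rounds -/

section Phase1z

variable (P : PCells2) (y : Site 2) (P₁ : LocPrm) (hP₁ : LocOK P₁) (z : ℕ)

/-- **The first core of the v-rounds contains the arrival box** (`scheduleNz`; same cores as `scheduleN`). [cite: KozmaNitzan2024, §4 p. 26 (M_v)] -/
theorem phase1z_core_zero_supset_M (hL : 3 * (P.r 1 : ℤ) ≤ P₁.L0) (hW : 3 * (P.r 0 : ℤ) ≤ P₁.W) :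
    P.M y ⊆ (P₁.scheduleNz 1 (P.cen y) hP₁ z).core 0 :=
  phase1_core_zero_supset_M P y P₁ hP₁ hL hW

/-- **Every region of the v-rounds lies in the cube box** (`scheduleNz`). [cite: KozmaNitzan2024, §4 p. 26 (Q_v)] -/
theorem phase1z_region_subset_Q (hL : max (P₁.L0 : ℤ) P₁.sHi + P₁.e + P₁.La ≤ 5 * (P.r 1 : ℤ)) (hW : P₁.Wk P₁.N + P₁.e + P₁.Lb ≤ 5 * (P.r 0 : ℤ))
    {k : ℕ} (hk : k ≤ P₁.N) : (P₁.scheduleNz 1 (P.cen y) hP₁ z).region k ⊆ P.Q y :=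
  phase1_region_subset_Q P y P₁ hP₁ hL hW hk

/-- **The last core of the v-rounds** (`scheduleNz`): `|t₁ − cen₁| ≤ sHi`, `|t₀ − cen₀| ≤ W + (N+1)e`. [cite: KozmaNitzan2024, §4 Lemma 12 (pp. 23–25)] -/
theorem phase1z_mem_core_last (hN : (P₁.L0 : ℤ) ≤ P₁.sHi + ((P₁.N : ℤ) + 1) * (P₁.sLo - P₁.e)) {t : Site 2} :
    t ∈ (P₁.scheduleNz 1 (P.cen y) hP₁ z).core (P₁.N + 1) ↔ |t 1 - P.cen y 1| ≤ P₁.sHi ∧ |t 0 - P.cen y 0| ≤ P₁.W + ((P₁.N : ℤ) + 1) * P₁.e :=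
  phase1_mem_core_last P y P₁ hP₁ hN

/-- `scheduleNz` has `N = P₁.N` and `R' = e − z`. [folklore] -/
theorem phase1z_params : (P₁.scheduleNz 1 (P.cen y) hP₁ z).N = P₁.N ∧ (P₁.scheduleNz 1 (P.cen y) hP₁ z).R' = P₁.e - z := ⟨rfl, rfl⟩

end Phase1z

/-! ## §2 The run-frame segment with a signed band -/

section Phase23S

variable (P₂ : LocPrm) (hP₂ : LocOK P₂) (B : RunPrm) (aB : Fin 2) {σB : ℤ} (hσB : σB = 1 ∨ σB = -1) (hB : RunOK B) (heb : B.eb = B.ea)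

/-- **Join of the u-rounds into a signed x-band** (`aB = 0`, either sign): `L₂(N₂+1) ≤ q`, `Wk₂(N₂+1) ≤ Wm, Wp`. [folklore] -/
theorem join_xS (hq : P₂.L (P₂.N + 1) ≤ B.q) (hWm : P₂.Wk (P₂.N + 1) ≤ B.Wm) (hWp : P₂.Wk (P₂.N + 1) ≤ B.Wp) :
    (P₂.scheduleN 0 0 hP₂).core (P₂.N + 1) ⊆ (B.scheduleN 0 hσB 0 hB heb).core 0 := by
  intro t ht
  rw [LocPrm.mem_scheduleN_core_iff] at ht
  rw [RunPrm.mem_scheduleN_core_zero]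
  simp only [Pi.zero_apply, sub_zero, oth_zero''] at ht ⊢
  obtain ⟨ha, hb⟩ := ht
  rw [abs_le] at ha hb
  rcases hσB with hs | hs <;> subst hs <;> exact ⟨⟨by linarith, by linarith⟩, by linarith, by linarith⟩

/-- **Join of the u-rounds into a signed y′-band** (`aB = 1`, either sign): `Wk₂(N₂+1) ≤ q`, `L₂(N₂+1) ≤ Wm, Wp`. [folklore] -/
theorem join_yS (hq : P₂.Wk (P₂.N + 1) ≤ B.q) (hWm : P₂.L (P₂.N + 1) ≤ B.Wm) (hWp : P₂.L (P₂.N + 1) ≤ B.Wp) :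
    (P₂.scheduleN 0 0 hP₂).core (P₂.N + 1) ⊆ (B.scheduleN 1 hσB 0 hB heb).core 0 := by
  intro t ht
  rw [LocPrm.mem_scheduleN_core_iff] at ht
  rw [RunPrm.mem_scheduleN_core_zero]
  simp only [Pi.zero_apply, sub_zero, oth_zero'', oth_one''] at ht ⊢
  obtain ⟨ha, hb⟩ := ht
  rw [abs_le] at ha hb
  rcases hσB with hs | hs <;> subst hs <;> exact ⟨⟨by linarith, by linarith⟩, by linarith, by linarith⟩

/-- **The signed x-band's start box lies in the rounds' last region** (`aB = 0`): `q ≤ L₂ N₂ + e + La`, `Wm, Wp ≤ Wk₂ N₂ + e + Lb`. [folklore] -/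
theorem joinReg_xS (hq : (B.q : ℤ) ≤ P₂.L P₂.N + P₂.e + P₂.La) (hWm : (B.Wm : ℤ) ≤ P₂.Wk P₂.N + P₂.e + P₂.Lb)
    (hWp : (B.Wp : ℤ) ≤ P₂.Wk P₂.N + P₂.e + P₂.Lb) :
    (B.scheduleN 0 hσB 0 hB heb).core 0 ⊆ (P₂.scheduleN 0 0 hP₂).region P₂.N := by
  intro t ht
  rw [RunPrm.mem_scheduleN_core_zero] at ht
  rw [LocPrm.scheduleN_region, LocPrm.mem_pregion_iff]
  simp only [Pi.zero_apply, sub_zero, oth_zero''] at ht ⊢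
  obtain ⟨⟨ha1, ha2⟩, hb1, hb2⟩ := ht
  rcases hσB with hs | hs <;> subst hs <;> exact ⟨abs_le.2 ⟨by linarith, by linarith⟩, abs_le.2 ⟨by linarith, by linarith⟩⟩

/-- **The signed y′-band's start box lies in the rounds' last region** (`aB = 1`): `Wm, Wp ≤ L₂ N₂ + e + La`, `q ≤ Wk₂ N₂ + e + Lb`. [folklore] -/
theorem joinReg_yS (hq : (B.q : ℤ) ≤ P₂.Wk P₂.N + P₂.e + P₂.Lb) (hWm : (B.Wm : ℤ) ≤ P₂.L P₂.N + P₂.e + P₂.La)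
    (hWp : (B.Wp : ℤ) ≤ P₂.L P₂.N + P₂.e + P₂.La) :
    (B.scheduleN 1 hσB 0 hB heb).core 0 ⊆ (P₂.scheduleN 0 0 hP₂).region P₂.N := by
  intro t ht
  rw [RunPrm.mem_scheduleN_core_zero] at ht
  rw [LocPrm.scheduleN_region, LocPrm.mem_pregion_iff]
  simp only [Pi.zero_apply, sub_zero, oth_zero'', oth_one''] at ht ⊢
  obtain ⟨⟨ha1, ha2⟩, hb1, hb2⟩ := ht
  rcases hσB with hs | hs <;> subst hs <;> exact ⟨abs_le.2 ⟨by linarith, by linarith⟩, abs_le.2 ⟨by linarith, by linarith⟩⟩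

/-- **THE RUN-FRAME SEGMENT OF THE (C) CORRIDOR, SIGNED BAND**: the u-rounds `P₂` (axis `0`, centre `0`) followed by the band `B` along `aB` with sign
`σB`, origin `0`, joined by containment. [cite: KozmaNitzan2024, §4 Lemma 12 (pp. 23–25)] -/
def corrRunSchedS (hR : B.ea = P₂.e)
    (hjoin : (P₂.scheduleN 0 0 hP₂).core (P₂.N + 1) ⊆ (B.scheduleN aB hσB 0 hB heb).core 0)
    (hreg : (B.scheduleN aB hσB 0 hB heb).core 0 ⊆ (P₂.scheduleN 0 0 hP₂).region P₂.N) : ScheduleN :=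
  (P₂.scheduleN 0 0 hP₂).appendN' (B.scheduleN aB hσB 0 hB heb) hR hjoin hreg

variable (hR : B.ea = P₂.e) (hjoin : (P₂.scheduleN 0 0 hP₂).core (P₂.N + 1) ⊆ (B.scheduleN aB hσB 0 hB heb).core 0)
  (hreg : (B.scheduleN aB hσB 0 hB heb).core 0 ⊆ (P₂.scheduleN 0 0 hP₂).region P₂.N)

/-- Parameters: `N = N₂ + 1 + B.N`, `R' = e`, prism `= pprism₂ ∪ B.pprism aB σB 0`. [folklore] -/
theorem corrRunSchedS_params : (corrRunSchedS P₂ hP₂ B aB hσB hB heb hR hjoin hreg).N = P₂.N + 1 + B.N ∧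
    (corrRunSchedS P₂ hP₂ B aB hσB hB heb hR hjoin hreg).R' = P₂.e ∧
    (corrRunSchedS P₂ hP₂ B aB hσB hB heb hR hjoin hreg).prism = P₂.pprism 0 0 ∪ B.pprism aB σB 0 :=
  ⟨rfl, rfl, rfl⟩

/-- The first core is the rounds' start box `pcore₂ 0`. [folklore] -/
theorem corrRunSchedS_core_zero : (corrRunSchedS P₂ hP₂ B aB hσB hB heb hR hjoin hreg).core 0 = P₂.pcore 0 0 0 :=
  ScheduleN.appendN'_core_zero _ _ hR hjoin hreg

/-- The last core is the band's last core. [folklore] -/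
theorem corrRunSchedS_core_last :
    (corrRunSchedS P₂ hP₂ B aB hσB hB heb hR hjoin hreg).core ((corrRunSchedS P₂ hP₂ B aB hσB hB heb hR hjoin hreg).N + 1) =
      B.pcore aB σB 0 (B.N + 1) :=
  ScheduleN.appendN'_core_last _ _ hR hjoin hreg

/-- The rounds' steps (`k ≤ N₂`): axis `0`, region `pregion₂ k`, core `pcore₂ k`. [folklore] -/
theorem corrRunSchedS_left {k : ℕ} (hk : k ≤ P₂.N) : (corrRunSchedS P₂ hP₂ B aB hσB hB heb hR hjoin hreg).ax k = 0 ∧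
    (corrRunSchedS P₂ hP₂ B aB hσB hB heb hR hjoin hreg).region k = P₂.pregion 0 0 k ∧
    (corrRunSchedS P₂ hP₂ B aB hσB hB heb hR hjoin hreg).core k = P₂.pcore 0 0 k := by
  have h := ScheduleN.appendN'_left (P₂.scheduleN 0 0 hP₂) (B.scheduleN aB hσB 0 hB heb) hR hjoin hreg hk
  exact ⟨h.1, h.2.1, h.2.2.2.1⟩

/-- The band's steps (`N₂ + 1 + j`): axis `aB`, region `B.pregion aB σB 0 j`, core `B.pcore aB σB 0 j`. [folklore] -/
theorem corrRunSchedS_right (j : ℕ) : (corrRunSchedS P₂ hP₂ B aB hσB hB heb hR hjoin hreg).ax (P₂.N + 1 + j) = aB ∧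
    (corrRunSchedS P₂ hP₂ B aB hσB hB heb hR hjoin hreg).region (P₂.N + 1 + j) = B.pregion aB σB 0 j ∧
    (corrRunSchedS P₂ hP₂ B aB hσB hB heb hR hjoin hreg).core (P₂.N + 1 + j) = B.pcore aB σB 0 j := by
  have h := ScheduleN.appendN'_right (P₂.scheduleN 0 0 hP₂) (B.scheduleN aB hσB 0 hB heb) hR hjoin hreg j
  exact ⟨h.1, h.2.1, h.2.2.2.1⟩

/-- **Every region of the run-frame segment is a rounds' region or a band region.** [folklore] -/
theorem corrRunSchedS_region_cases {k : ℕ} (hk : k ≤ (corrRunSchedS P₂ hP₂ B aB hσB hB heb hR hjoin hreg).N) :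
    (k ≤ P₂.N ∧ (corrRunSchedS P₂ hP₂ B aB hσB hB heb hR hjoin hreg).region k = P₂.pregion 0 0 k) ∨
      (∃ j ≤ B.N, k = P₂.N + 1 + j ∧ (corrRunSchedS P₂ hP₂ B aB hσB hB heb hR hjoin hreg).region k = B.pregion aB σB 0 j) := by
  by_cases hk' : k ≤ P₂.N
  · exact Or.inl ⟨hk', (corrRunSchedS_left P₂ hP₂ B aB hσB hB heb hR hjoin hreg hk').2.1⟩
  · push Not at hk'
    have hN : (corrRunSchedS P₂ hP₂ B aB hσB hB heb hR hjoin hreg).N = P₂.N + 1 + B.N := rfl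
    refine Or.inr ⟨k - (P₂.N + 1), by omega, by omega, ?_⟩
    have e : k = P₂.N + 1 + (k - (P₂.N + 1)) := by omega
    conv_lhs => rw [e]
    exact (corrRunSchedS_right P₂ hP₂ B aB hσB hB heb hR hjoin hreg _).2.1

end Phase23S

end ChainPara

end Transplant

end Summit.CriticalPhenomena.PercolationContinuityZ3.Theorems

end
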